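import Mathlib.LinearAlgebra.Matrix.PosDef
import HarnessLib

/-!
# Rank-one domination `s·L − c cᵀ ⪰ 0` certified by ONE linear solve

For a real positive semidefinite matrix `L`, a vector `v` with `L v = c` and a scalar `s ≥ cᵀv`
(`cᵀv = vᵀLv`, which is `cᵀL⁻¹c` when `L ≻ 0`), the matrix `s·L − c cᵀ` is positive semidefinite:
for every `x`, `(cᵀx)² = (vᵀLx)² ≤ (vᵀLv)(xᵀLx) ≤ s·(xᵀLx)` — Cauchy–Schwarz for the semi-inner
product `⟨u, w⟩ = uᵀLw`. This is the block criterion `[[s, cᵀ], [c, L]] ≻ 0 ⇔ L ≻ 0 ∧ s − cᵀL⁻¹c > 0`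
[cite: HornJohnson2013, Thm 7.7.7 (a)⇔(b)], [cite: BlekhermanParriloThomas2012, App. A.1.4] in the
one-sided, semidefinite form that an EXACT RATIONAL certificate can use without inverting `L` in the
kernel and without one `LDLᵀ` per rank-one fact: a family of facts `s_k·L − c_k c_kᵀ ⪰ 0` (`k ∈ κ`,
all against the SAME `L`, the `c_k` supported on few coordinates) is certified by ONE tabulated exact
solve `L·W = E` (`W` = the needed columns of `L⁻¹`, checked by `decide` as a matrix identity) and the
scalar inequalities `s_k ≥ c_kᵀ(W u_k)` with `c_k = E u_k` (`posSemidef_smul_sub_vecMulVec_of_mul_eq`).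
Consumer: the rank-one level facts `s_k·(lower matrix) − C_kᵀC_k ⪰ 0` of
`LPSlabCertificate.well_subset_regionOfAttraction_of_rankOne` (Lur'e–Postnikov slab certificates of
multimachine power systems), where `κ` has hundreds of channels and `L` is `19 × 19` and larger.

## Contents (namespace `Literature.Computation.Certificates`)

* `dotProduct_mulVec_sq_le_of_posSemidef` — Cauchy–Schwarz `(vᵀLx)² ≤ (vᵀLv)(xᵀLx)` for `L ⪰ 0`
  [cite: HornJohnson2013, Thm 5.1.8] (symmetry / nonnegativity / expansion are private plumbing);
* `posSemidef_smul_sub_vecMulVec_of_mulVec_eq` — `L ⪰ 0`, `Lv = c`, `cᵀv ≤ s` ⇒ `s·L − ccᵀ ⪰ 0`;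
* `posSemidef_smul_sub_vecMulVec_of_mul_eq` — the tabulated form `L·W = E`, `c = E u`, `cᵀ(W u) ≤ s`;
* `posSemidef_map_smul_sub_vecMulVec_of_mulVec_eq` / `_of_mul_eq` — the same for a RATIONAL `L`, `v`/`W`,
  `c`, `s` (hypotheses decidable on literals), conclusion over `ℝ` in the consumers' cast shape
  `((s : ℚ) : ℝ) • L.map Rat.cast − vecMulVec (Rat.cast ∘ c) (Rat.cast ∘ c)`.

All statements are proved; no named facts.
-/

namespace Literature.Computation.Certificates

open Matrix

variable {n m : Type*} [Fintype n] [Fintype m]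

/-- Symmetry of the semi-inner product of a real positive semidefinite matrix: `xᵀLv = vᵀLx`
(plumbing). [folklore] -/
private theorem dotProduct_mulVec_comm_of_posSemidef {L : Matrix n n ℝ} (hL : L.PosSemidef) (v x : n → ℝ) :
    x ⬝ᵥ L *ᵥ v = v ⬝ᵥ L *ᵥ x := by
  have hT : Lᵀ = L := by
    have h := hL.1
    rw [IsHermitian, conjTranspose_eq_transpose_of_trivial] at h
    exact h
  calc x ⬝ᵥ L *ᵥ v = (x ᵥ* L) ⬝ᵥ v := dotProduct_mulVec x L v
    _ = (Lᵀ *ᵥ x) ⬝ᵥ v := by rw [mulVec_transpose]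
    _ = v ⬝ᵥ L *ᵥ x := by rw [hT, dotProduct_comm]

/-- The quadratic form of a real positive semidefinite matrix is nonnegative (trivial-star form,
plumbing). [folklore] -/
private theorem dotProduct_mulVec_self_nonneg_of_posSemidef {L : Matrix n n ℝ} (hL : L.PosSemidef)
    (x : n → ℝ) : 0 ≤ x ⬝ᵥ L *ᵥ x := by
  simpa using hL.dotProduct_mulVec_nonneg x

/-- Expansion of the quadratic form at `α·v + β·x` (plumbing). [folklore] -/
private theorem quadForm_expand {L : Matrix n n ℝ} (hL : L.PosSemidef) (v x : n → ℝ) (α β : ℝ) :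
    (α • v + β • x) ⬝ᵥ L *ᵥ (α • v + β • x)
      = α ^ 2 * (v ⬝ᵥ L *ᵥ v) + 2 * α * β * (v ⬝ᵥ L *ᵥ x) + β ^ 2 * (x ⬝ᵥ L *ᵥ x) := by
  have hsym := dotProduct_mulVec_comm_of_posSemidef hL v x
  simp only [mulVec_add, mulVec_smul, dotProduct_add, add_dotProduct, dotProduct_smul,
    smul_dotProduct, smul_eq_mul, hsym]
  ring

/-- **Cauchy–Schwarz for the semi-inner product of a positive semidefinite matrix**:
`(vᵀLx)² ≤ (vᵀLv)·(xᵀLx)` for real `L ⪰ 0` (`⟨x, y⟩ = yᵀLx` is a semi-inner product).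
[cite: HornJohnson2013, Thm 5.1.8] -/
theorem dotProduct_mulVec_sq_le_of_posSemidef {L : Matrix n n ℝ} (hL : L.PosSemidef) (v x : n → ℝ) :
    (v ⬝ᵥ L *ᵥ x) ^ 2 ≤ (v ⬝ᵥ L *ᵥ v) * (x ⬝ᵥ L *ᵥ x) := by
  set a := v ⬝ᵥ L *ᵥ v with ha_def
  set b := v ⬝ᵥ L *ᵥ x with hb_def
  set q := x ⬝ᵥ L *ᵥ x with hq_def
  have ha : 0 ≤ a := dotProduct_mulVec_self_nonneg_of_posSemidef hL v
  have hq : 0 ≤ q := dotProduct_mulVec_self_nonneg_of_posSemidef hL x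
  rcases ha.lt_or_eq with ha' | ha'
  · -- `a > 0`: `0 ≤ Q(b·v − a·x) = a (a q − b²)`
    have h0 := dotProduct_mulVec_self_nonneg_of_posSemidef hL (b • v + (-a) • x)
    rw [quadForm_expand hL] at h0
    have h1 : 0 ≤ a * (a * q - b ^ 2) := by nlinarith [h0]
    have h2 : 0 ≤ a * q - b ^ 2 := by
      by_contra h; push Not at h; nlinarith [mul_neg_of_pos_of_neg ha' h]
    nlinarith [h2]
  · -- `a = 0`: then `b = 0` (else `Q(t·v + x) = 2tb + q < 0` for a suitable `t`)
    have hb : b = 0 := by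
      by_contra hb
      have h0 := dotProduct_mulVec_self_nonneg_of_posSemidef hL ((-(q + 1) / (2 * b)) • v + (1 : ℝ) • x)
      rw [quadForm_expand hL, ← ha_def, ← ha'] at h0
      have : 2 * (-(q + 1) / (2 * b)) * 1 * b = -(q + 1) := by field_simp
      nlinarith [this, h0]
    rw [hb, ← ha']; simp

/-- **Rank-one domination from one linear solve**: for real `L ⪰ 0`, `L v = c` and `cᵀv ≤ s` imply
`s·L − c cᵀ ⪰ 0`. (`cᵀv = vᵀLv = cᵀL⁻¹c` when `L ≻ 0`: the Schur-complement criterion for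
`[[s, cᵀ], [c, L]]`.) [cite: HornJohnson2013, Thm 7.7.7], [cite: BlekhermanParriloThomas2012, App. A.1.4] -/
theorem posSemidef_smul_sub_vecMulVec_of_mulVec_eq {L : Matrix n n ℝ} (hL : L.PosSemidef)
    {v c : n → ℝ} (hv : L *ᵥ v = c) {s : ℝ} (hs : c ⬝ᵥ v ≤ s) :
    (s • L - vecMulVec c c).PosSemidef := by
  have hsymm := dotProduct_mulVec_comm_of_posSemidef hL
  refine PosSemidef.of_dotProduct_mulVec_nonneg ?_ fun x => ?_
  · -- Hermitian (real symmetric)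
    refine IsHermitian.sub (hL.1.smul (IsSelfAdjoint.all s)) ?_
    exact Matrix.IsHermitian.ext fun i j => by
      rw [star_trivial, vecMulVec_apply, vecMulVec_apply, mul_comm]
  · -- the quadratic form: `s·xᵀLx − (cᵀx)²`, with `cᵀx = vᵀLx`
    have hcx : c ⬝ᵥ x = v ⬝ᵥ L *ᵥ x := by
      rw [← hv, dotProduct_comm, hsymm v x]
    have hcv : c ⬝ᵥ v = v ⬝ᵥ L *ᵥ v := by rw [← hv, dotProduct_comm]
    have hq : 0 ≤ x ⬝ᵥ L *ᵥ x := dotProduct_mulVec_self_nonneg_of_posSemidef hL x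
    have hcs := dotProduct_mulVec_sq_le_of_posSemidef hL v x
    have hform : star x ⬝ᵥ (s • L - vecMulVec c c) *ᵥ x
        = s * (x ⬝ᵥ L *ᵥ x) - (c ⬝ᵥ x) ^ 2 := by
      simp only [star_trivial, sub_mulVec, smul_mulVec, vecMulVec_mulVec, dotProduct_sub,
        dotProduct_smul, op_smul_eq_smul, smul_eq_mul, dotProduct_comm x c]
      ring
    rw [hform, hcx]
    rw [hcv] at hs
    nlinarith [hcs, mul_le_mul_of_nonneg_right hs hq]

/-- **The tabulated form**: ONE exact solve `L·W = E` for a table of right-hand sides serves every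
rank-one fact whose vector lies in the column span of `E`: `L ⪰ 0`, `L·W = E`, `c = E u`,
`cᵀ(W u) ≤ s` ⇒ `s·L − c cᵀ ⪰ 0` (the Schur-complement criterion with `cᵀL⁻¹c` read off a solve).
[cite: HornJohnson2013, Thm 7.7.7], [cite: BlekhermanParriloThomas2012, App. A.1.4] -/
theorem posSemidef_smul_sub_vecMulVec_of_mul_eq {L : Matrix n n ℝ} (hL : L.PosSemidef)
    {W E : Matrix n m ℝ} (hW : L * W = E) (u : m → ℝ) {c : n → ℝ} (hc : E *ᵥ u = c) {s : ℝ}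
    (hs : c ⬝ᵥ W *ᵥ u ≤ s) : (s • L - vecMulVec c c).PosSemidef :=
  posSemidef_smul_sub_vecMulVec_of_mulVec_eq hL (v := W *ᵥ u) (by rw [mulVec_mulVec, hW, hc]) hs

/-! ### Rational data, real conclusion -/

/-- **Rational certificate, real conclusion**: for a rational `L` whose real cast is `⪰ 0` (e.g. by
`PSD.LDLCert`), a rational solve `L v = c` and `cᵀv ≤ s` (both decidable on literals) give
`s·L − c cᵀ ⪰ 0` over `ℝ` (stated in the cast shape the slab-certificate consumers use).
[cite: HornJohnson2013, Thm 7.7.7], [cite: BlekhermanParriloThomas2012, App. A.1.4] -/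
theorem posSemidef_map_smul_sub_vecMulVec_of_mulVec_eq {L : Matrix n n ℚ}
    (hL : (L.map (Rat.cast : ℚ → ℝ)).PosSemidef) {v c : n → ℚ} (hv : L *ᵥ v = c) {s : ℚ}
    (hs : c ⬝ᵥ v ≤ s) :
    (((s : ℚ) : ℝ) • L.map (Rat.cast : ℚ → ℝ)
      - vecMulVec (fun i => ((c i : ℚ) : ℝ)) (fun i => ((c i : ℚ) : ℝ))).PosSemidef := by
  refine posSemidef_smul_sub_vecMulVec_of_mulVec_eq hL (v := fun i => ((v i : ℚ) : ℝ)) ?_ ?_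
  · ext i
    have h := congrFun hv i
    simp only [mulVec, dotProduct] at h ⊢
    rw [← h]; push_cast; simp [map_apply]
  · have : (fun i => ((c i : ℚ) : ℝ)) ⬝ᵥ (fun i => ((v i : ℚ) : ℝ)) = ((c ⬝ᵥ v : ℚ) : ℝ) := by
      simp [dotProduct]
    rw [this]; exact_mod_cast hs

/-- **Rational tabulated form**: `L·W = E`, `c = E u`, `cᵀ(W u) ≤ s` over `ℚ` (all decidable on
literals) ⇒ `s·L − c cᵀ ⪰ 0` over `ℝ`.
[cite: HornJohnson2013, Thm 7.7.7], [cite: BlekhermanParriloThomas2012, App. A.1.4] -/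
theorem posSemidef_map_smul_sub_vecMulVec_of_mul_eq {L : Matrix n n ℚ}
    (hL : (L.map (Rat.cast : ℚ → ℝ)).PosSemidef) {W E : Matrix n m ℚ} (hW : L * W = E) (u : m → ℚ)
    {c : n → ℚ} (hc : E *ᵥ u = c) {s : ℚ} (hs : c ⬝ᵥ W *ᵥ u ≤ s) :
    (((s : ℚ) : ℝ) • L.map (Rat.cast : ℚ → ℝ)
      - vecMulVec (fun i => ((c i : ℚ) : ℝ)) (fun i => ((c i : ℚ) : ℝ))).PosSemidef :=
  posSemidef_map_smul_sub_vecMulVec_of_mulVec_eq hL (v := W *ᵥ u) (by rw [mulVec_mulVec, hW, hc]) hs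

end Literature.Computation.Certificates
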